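import Summits.BirchSwinnertonDyer.BirchSwinnertonDyer.Theorems.Rank2ShaTierKit
import Summits.BirchSwinnertonDyer.BirchSwinnertonDyer.Theorems.Rank1ResidualX11RankOneMinimality
import Summits.BirchSwinnertonDyer.BirchSwinnertonDyer.Theorems.Rank2ObservatoryRank3MinimalCensus
import HarnessLib

/-!
# BirchSwinnertonDyer — rank-2 `Ш[p^∞]` cell: the TIER KIT with the COMPLETE minimality criterion
# (Kraus's conditions at `2` and `3`; frame «kato-bound», `p ≥ 5`)

HONEST FRAMING (cell `b2b-bsdr2sha`, run/shared/lean/b2b/bsd-rank2-sha/): per-pair certified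
theorems «cited hypotheses ∧ certified computation ⇒ `Ш(E/ℚ)[p^∞]` finite of order `p^k`» for
rank-2 curves at good ordinary primes; NO claim on BSD in rank `≥ 2`, no class-level theorem, every
published input is a NAMED HYPOTHESIS of the tree (nothing is asserted or minted here).

The base kit `Rank2ShaTierKit.lean` certifies global minimality of the row's integer model by one of
the three kernel criteria of the observatory atlas kit (`minCheck`: `q¹² ∤ Δ ∨ q ∤ c₄`; `minCheck₂`:
Kraus at `2` in the form `2⁸ ∤ c₄ ∧ 2⁸ ∤ c₆ + 64` when `2` is the ONLY prime escaping `minCheck`;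
`minCheck₃`: `q¹² ∤ Δ ∨ q⁴ ∤ c₄ ∨` the `c₆`-congruence form of Kraus at `2`). Thirteen census curves
(`54` cells of the G2 slices 8–11 and 20) escape all three: the six models `31509a1`, `45603b1`,
`46251c1`, `52083b1`, `55161b1`, `66177c1` have `ord₃ c₄ ≥ 4`, `ord₃ Δ ≥ 12`, `ord₃ c₆ = 8` (minimal
at `3` by KRAUS'S CONDITION AT `3`: an integral model has `ord₃ c₆ ≠ 2`), and the seven models
`54720er1`, `55584k1`, `55872h1`, `65600bk1`, `83520fw1`, `86976co1`, `86976cq1` have `ord₂ c₄ ∈ {6, 7}`,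
`ord₂ c₆ ≥ 9` together with a SECOND prime `q ∈ {3, 5}` with `q¹² ∣ Δ`, `q ∣ c₄`, `q⁴ ∤ c₄` (so
`minCheck₂`'s "only `2` escapes" clause fails and `minCheck₃`'s `2¹¹ ∤ c₆` fails).

This file (theorems + three `Bool` tests, no new mathematical object, no axiom, no `sorry`):
* `isGloballyMinimal_baseChange_int_of_kraus₂₃` — an integer model is globally minimal when every
  prime `q` has `q¹² ∤ Δ ∨ q⁴ ∤ c₄` (Silverman VII.1 Rem. 1.1), or `q = 2 ∧ 2⁸ ∤ c₄ ∧ 2⁷ ∣ c₆`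
  (Kraus at `2`), or `q = 3 ∧ 3⁸ ∣ c₆ ∧ 3⁹ ∤ c₆` (Kraus at `3`) — a TRANSPORT of the sibling cell's
  `Summit.BirchSwinnertonDyer.BirchSwinnertonDyer.Rank1Residual.X11RankOne.isGloballyMinimal_of_krausCriterion` (stated there on the recomputed
  integers `discOf/c4Of/c6Of` of five a-invariants) to Mathlib's `Δ, c₄, c₆` of `W₀ : WeierstrassCurve ℤ`
  (bridges: the observatory's `discOf_eq`, `c4Of_eq` and the new `c6Of_eq_c₆`);
* `ShaRow.minCheck₄` (the finite Boolean form with the row's bound `B`: `Δ ≠ 0`, `|Δ| < B¹²`, the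
  disjunction for every `2 ≤ q < B`) and its soundness `ShaRow.isGloballyMinimal_of_minCheck₄`;
* `ShaRow.check₄` / `ShaRow.checkK₄` — the base / kato-bound kernel tests of `Rank2ShaTierKit` with the
  minimality slot replaced by `minCheck₄` (everything else byte-identical), their unpacking
  `check₄_spec`, the bundled soundness `prime_isElliptic_isGloballyMinimal_of_check₄`,
  `isOrdinaryAt_reductionPointCount_tamagawaProduct_of_check₄`;
* the row theorems `ShaRow.kato₄` (`ord_p #Ш(E/ℚ)[p^∞] ≤ R.k`), `ShaRow.kato₄_eq_one` (`R.k ≤ 0 ⇒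
  Ш(E/ℚ)[p^∞] = 0`) — the tree's `card_shaPrimary_le_of_kato_certificate` exactly as in `ShaRow.kato`;
* READERS `ShaRow.booked_katoOne₄` (certificate `R.checkK₄ = true ∧ R.k ≤ 0 ∧ 2 ≤ rank`) and
  `ShaRow.booked_katoLe₄` (`R.checkK₄ = true ∧ 2 ≤ rank`), binders exactly the kato tier's.

References: A. Kraus, *Quelques remarques à propos des invariants c₄, c₆ et Δ d'une courbe elliptique*,
Acta Arith. 54 (1989) 75–80, Prop. 1 (`p = 3`), Prop. 2 (`p = 2`) [Kraus1989]; J. H. Silverman, *AEC*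
(2009) VII.1 Remark 1.1, VIII.8 [SilvermanAEC2009]; K. Kato, Astérisque 295 (2004), Thm. 17.4
[Kato2004Asterisque]; J.-P. Serre, Invent. Math. 15 (1972), §2.8 Prop. 19 [Serre1972]; W. Stein,
C. Wuthrich, Math. Comp. 82 (2013), Alg. 11.1 [SteinWuthrich2013]; J. Balakrishnan, J. S. Müller,
W. Stein, Math. Comp. 85 (2016), Thm. 1.7 [BalakrishnanMullerStein2015].
-/

set_option autoImplicit false

-- single-conjunct summit: `Summit.BirchSwinnertonDyer.BirchSwinnertonDyer.…` repeats the name by design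
set_option linter.dupNamespace false

noncomputable section

open scoped Classical MatrixGroups ModularForm

open CongruenceSubgroup WeierstrassCurve Literature.NumberTheory.EllipticCurves
  Literature.NumberTheory.EllipticCurves.ModularForms
  Literature.NumberTheory.EllipticCurves.Rank1Residual
  Literature.NumberTheory.EllipticCurves.Rank1Residual.X11RankOneCertificates
  Summit.BirchSwinnertonDyer.BirchSwinnertonDyer.Rank2Observatory

namespace Summit.BirchSwinnertonDyer.BirchSwinnertonDyer.Rank2Sha

/-! ## §1. Kraus's conditions at `2` and `3` on an integer model -/

/-- The sibling cell's recomputed `c6Of [a₁,…,a₆]` of an integer model is Mathlib's `c₆` (companion of the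
observatory's `discOf_eq` / `c4Of_eq` in `Rank2ObservatoryRank3MinimalCensus`). [cite: SilvermanAEC2009, III.1] -/
theorem c6Of_eq_c₆ (W₀ : WeierstrassCurve ℤ) :
    c6Of [W₀.a₁, W₀.a₂, W₀.a₃, W₀.a₄, W₀.a₆] = W₀.c₆ := by
  simp only [c6Of, invariants, WeierstrassCurve.c₆, WeierstrassCurve.b₂, WeierstrassCurve.b₄,
    WeierstrassCurve.b₆]
  ring

/-- `W₀ ⊗ ℚ` is the rational Weierstrass equation with the same five coefficients. [folklore] -/
theorem baseChange_int_eq_mk (W₀ : WeierstrassCurve ℤ) :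
    W₀.baseChange ℚ = (⟨W₀.a₁, W₀.a₂, W₀.a₃, W₀.a₄, W₀.a₆⟩ : WeierstrassCurve ℚ) := by
  cases W₀
  rfl

/-- **Global minimality of an integer model from Silverman's criterion or a Kraus pattern at every
prime** (transport of the sibling cell's `isGloballyMinimal_of_krausCriterion` to Mathlib's invariants):
if every prime `q` has `q¹² ∤ Δ` or `q⁴ ∤ c₄`, or `q = 2 ∧ 2⁸ ∤ c₄ ∧ 2⁷ ∣ c₆` (Kraus at `2`), or
`q = 3 ∧ 3⁸ ∣ c₆ ∧ 3⁹ ∤ c₆` (Kraus at `3`: an integral model has `ord₃ c₆ ≠ 2`, and a descent by `u`,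
`ord₃ u = m ≥ 1`, has `ord₃ c₆' = 8 − 6m`), then `W₀ ⊗ ℚ` is a global minimal equation.
[cite: Kraus1989, Prop. 1 and Prop. 2] [cite: SilvermanAEC2009, VII.1 Remark 1.1 and VIII.8] -/
theorem isGloballyMinimal_baseChange_int_of_kraus₂₃ (W₀ : WeierstrassCurve ℤ)
    (h : ∀ q : ℕ, q.Prime →
      (¬ (q : ℤ) ^ 12 ∣ W₀.Δ ∨ ¬ (q : ℤ) ^ 4 ∣ W₀.c₄) ∨
      (q = 2 ∧ ¬ (2 : ℤ) ^ 8 ∣ W₀.c₄ ∧ (2 : ℤ) ^ 7 ∣ W₀.c₆) ∨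
      (q = 3 ∧ (3 : ℤ) ^ 8 ∣ W₀.c₆ ∧ ¬ (3 : ℤ) ^ 9 ∣ W₀.c₆)) :
    (W₀.baseChange ℚ).IsGloballyMinimal := by
  rw [baseChange_int_eq_mk]
  refine Summit.BirchSwinnertonDyer.BirchSwinnertonDyer.Rank1Residual.X11RankOne.isGloballyMinimal_of_krausCriterion W₀.a₁ W₀.a₂ W₀.a₃ W₀.a₄ W₀.a₆ fun q hq => ?_
  rw [discOf_eq, c4Of_eq, c6Of_eq_c₆]
  rcases h q hq with h1 | h2 | h3
  · exact Or.inl h1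
  · exact Or.inr (Or.inl h2)
  · exact Or.inr (Or.inr (Or.inr h3))

/-- **Finite form.** If `Δ ≠ 0`, `|Δ| < B¹²` and every `2 ≤ q < B` satisfies the disjunction (on natural
numbers: `q¹² ∤ |Δ|`, `q⁴ ∤ |c₄|`, `q = 2 ∧ 2⁸ ∤ |c₄| ∧ 2⁷ ∣ |c₆|`, `q = 3 ∧ 3⁸ ∣ |c₆| ∧ 3⁹ ∤ |c₆|`), then
`W₀ ⊗ ℚ` is a global minimal equation (primes `q ≥ B` have `q¹² > |Δ|`).
[cite: Kraus1989, Prop. 1 and Prop. 2] [cite: SilvermanAEC2009, VII.1 Remark 1.1] -/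
theorem isGloballyMinimal_baseChange_int_of_kraus₂₃_bounded (W₀ : WeierstrassCurve ℤ) {B : ℕ}
    (hΔ : W₀.Δ ≠ 0) (hB : W₀.Δ.natAbs < B ^ 12)
    (hq : ∀ q < B, q < 2 ∨ ¬ q ^ 12 ∣ W₀.Δ.natAbs ∨ ¬ q ^ 4 ∣ W₀.c₄.natAbs ∨
      (q = 2 ∧ ¬ 2 ^ 8 ∣ W₀.c₄.natAbs ∧ 2 ^ 7 ∣ W₀.c₆.natAbs) ∨
      (q = 3 ∧ 3 ^ 8 ∣ W₀.c₆.natAbs ∧ ¬ 3 ^ 9 ∣ W₀.c₆.natAbs)) :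
    (W₀.baseChange ℚ).IsGloballyMinimal := by
  refine isGloballyMinimal_baseChange_int_of_kraus₂₃ W₀ fun q hprime => ?_
  have e12 : ((q : ℤ) ^ 12 ∣ W₀.Δ) ↔ q ^ 12 ∣ W₀.Δ.natAbs := by
    rw [← Int.natCast_dvd, Nat.cast_pow]
  have e4 : ((q : ℤ) ^ 4 ∣ W₀.c₄) ↔ q ^ 4 ∣ W₀.c₄.natAbs := by
    rw [← Int.natCast_dvd, Nat.cast_pow]
  have e2_8 : ((2 : ℤ) ^ 8 ∣ W₀.c₄) ↔ 2 ^ 8 ∣ W₀.c₄.natAbs := by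
    rw [← Int.natCast_dvd]; push_cast; exact Iff.rfl
  have e2_7 : ((2 : ℤ) ^ 7 ∣ W₀.c₆) ↔ 2 ^ 7 ∣ W₀.c₆.natAbs := by
    rw [← Int.natCast_dvd]; push_cast; exact Iff.rfl
  have e3_8 : ((3 : ℤ) ^ 8 ∣ W₀.c₆) ↔ 3 ^ 8 ∣ W₀.c₆.natAbs := by
    rw [← Int.natCast_dvd]; push_cast; exact Iff.rfl
  have e3_9 : ((3 : ℤ) ^ 9 ∣ W₀.c₆) ↔ 3 ^ 9 ∣ W₀.c₆.natAbs := by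
    rw [← Int.natCast_dvd]; push_cast; exact Iff.rfl
  by_cases hqB : q < B
  · rcases hq q hqB with hlt | h12 | h4' | ⟨h2, h8, h7⟩ | ⟨h3, h8, h9⟩
    · exact absurd hprime.two_le (by omega)
    · exact Or.inl (Or.inl fun h' => h12 (e12.mp h'))
    · exact Or.inl (Or.inr fun h' => h4' (e4.mp h'))
    · exact Or.inr (Or.inl ⟨h2, fun h' => h8 (e2_8.mp h'), e2_7.mpr h7⟩)
    · exact Or.inr (Or.inr ⟨h3, e3_8.mpr h8, fun h' => h9 (e3_9.mp h')⟩)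
  · refine Or.inl (Or.inl fun h' => ?_)
    have hpos : 0 < W₀.Δ.natAbs := Int.natAbs_pos.mpr hΔ
    have hle : q ^ 12 ≤ W₀.Δ.natAbs := Nat.le_of_dvd hpos (e12.mp h')
    have hBq : B ^ 12 ≤ q ^ 12 := Nat.pow_le_pow_left (not_lt.mp hqB) 12
    omega

/-! ## §2. The row tests with the complete minimality criterion -/

namespace ShaRow

variable (R : ShaRow)

/-- **The complete finite minimality criterion of a compact row**: `Δ ≠ 0`, `|Δ| < B¹²`, and for every
`2 ≤ q < B`: `q¹² ∤ |Δ|`, or `q⁴ ∤ |c₄|`, or `q = 2 ∧ 2⁸ ∤ |c₄| ∧ 2⁷ ∣ |c₆|` (Kraus at `2`), or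
`q = 3 ∧ 3⁸ ∣ |c₆| ∧ 3⁹ ∤ |c₆|` (Kraus at `3`). [cite: Kraus1989, Prop. 1 and Prop. 2]
[cite: SilvermanAEC2009, VII.1 Remark 1.1] -/
def minCheck₄ : Bool :=
  decide (R.e.Δ ≠ 0) && decide (R.e.Δ.natAbs < R.B ^ 12) &&
    (List.range R.B).all fun q =>
      decide (q < 2) || !decide (q ^ 12 ∣ R.e.Δ.natAbs) || !decide (q ^ 4 ∣ R.e.c₄.natAbs) ||
        (decide (q = 2) && !decide (2 ^ 8 ∣ R.e.c₄.natAbs) && decide (2 ^ 7 ∣ R.e.c₆.natAbs)) ||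
        (decide (q = 3) && decide (3 ^ 8 ∣ R.e.c₆.natAbs) && !decide (3 ^ 9 ∣ R.e.c₆.natAbs))

/-- **The BASE kernel test, complete minimality form**: `Rank2ShaTierKit`'s `ShaRow.check` with the
minimality slot `minCheck ∨ minCheck₂ ∨ minCheck₃` replaced by `minCheck₄` (the other conjuncts — `p`
prime by trial division, `5 ≤ p`, `p ∤ Δ`, `#Ẽ(𝔽_p) = p + 1 − a_p`, `p ∤ a_p`, the EXACT Tamagawa row
certificate — unchanged). [folklore] -/
def check₄ : Bool :=
  Tam.TamLocal.primeB R.p R.sq && decide (5 ≤ R.p) && decide (¬ ((R.p : ℤ) ∣ R.e.Δ)) &&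
    decide ((curveCount R.p R.e : ℤ) = R.p + 1 - R.ap) && decide (¬ ((R.p : ℤ) ∣ R.ap)) &&
    R.minCheck₄ &&
    Tam.TamZ.rowCheckZ R.tam R.tamX R.tamZ R.e && Tam.TamZ.rowExactZ R.tam R.tamX R.tamZ

/-- **The kernel test of frame «kato-bound», complete minimality form**: `check₄` AND the Serre witness
of `ρ̄_{E,p}` onto (H5). [cite: Serre1972, §2.8 Prop. 19] -/
def checkK₄ : Bool := R.check₄ && R.sw.check R.e R.p

variable {R}

/-- Soundness of the complete finite minimality criterion of a row. [cite: Kraus1989, Prop. 1 and Prop. 2]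
[cite: SilvermanAEC2009, VII.1 Remark 1.1] -/
theorem isGloballyMinimal_of_minCheck₄ (h : R.minCheck₄ = true) :
    (R.e.baseChange ℚ).IsGloballyMinimal := by
  simp only [minCheck₄, Bool.and_eq_true, decide_eq_true_eq, List.all_eq_true, List.mem_range,
    Bool.or_eq_true, Bool.not_eq_true', decide_eq_false_iff_not] at h
  obtain ⟨⟨hΔ, hB⟩, hq⟩ := h
  refine isGloballyMinimal_baseChange_int_of_kraus₂₃_bounded R.e hΔ hB fun q hqB => ?_
  rcases hq q hqB with (((hlt | h12) | h4) | ⟨⟨h2, h8⟩, h7⟩) | ⟨⟨h3, h8⟩, h9⟩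
  · exact Or.inl hlt
  · exact Or.inr (Or.inl h12)
  · exact Or.inr (Or.inr (Or.inl h4))
  · exact Or.inr (Or.inr (Or.inr (Or.inl ⟨h2, h8, h7⟩)))
  · exact Or.inr (Or.inr (Or.inr (Or.inr ⟨h3, h8, h9⟩)))

/-- A row passing `checkK₄` passes `check₄`. [folklore] -/
theorem check₄_of_checkK₄ (h : R.checkK₄ = true) : R.check₄ = true := by
  simp only [checkK₄, Bool.and_eq_true] at h; exact h.1

/-- A row passing `checkK₄` has a passing Serre witness. [folklore] -/
theorem swcheck_of_checkK₄ (h : R.checkK₄ = true) : R.sw.check R.e R.p = true := by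
  simp only [checkK₄, Bool.and_eq_true] at h; exact h.2

/-- From a tier theorem `rows.all checkK₄ = true` to the test of a member. [folklore] -/
theorem checkK₄_of_all {rows : List ShaRow} (hall : rows.all ShaRow.checkK₄ = true) {R : ShaRow}
    (hmem : R ∈ rows) : R.checkK₄ = true :=
  List.all_eq_true.mp hall R hmem

/-- Unpacking a passing complete-minimality base check. [folklore] -/
theorem check₄_spec (h : R.check₄ = true) :
    R.p.Prime ∧ 5 ≤ R.p ∧ ¬ ((R.p : ℤ) ∣ R.e.Δ) ∧ (curveCount R.p R.e : ℤ) = R.p + 1 - R.ap ∧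
      ¬ ((R.p : ℤ) ∣ R.ap) ∧ R.minCheck₄ = true ∧
      Tam.TamZ.rowCheckZ R.tam R.tamX R.tamZ R.e = true ∧
      Tam.TamZ.rowExactZ R.tam R.tamX R.tamZ = true := by
  simp only [check₄, Bool.and_eq_true, decide_eq_true_eq] at h
  obtain ⟨⟨⟨⟨⟨⟨⟨hP, h5⟩, hΔ⟩, hc⟩, hap⟩, hmin⟩, ht⟩, hx⟩ := h
  exact ⟨Tam.TamLocal.prime_of_primeB hP, h5, hΔ, hc, hap, hmin, ht, hx⟩

/-- A row passing `check₄` has `p` prime, `p ≥ 5`, an ELLIPTIC curve (`Δ ≠ 0` from `p ∤ Δ`) and a globally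
MINIMAL integer model (complete criterion) — bundled. [cite: Kraus1989, Prop. 1 and Prop. 2]
[cite: SilvermanAEC2009, VII.1 Remark 1.1] -/
theorem prime_isElliptic_isGloballyMinimal_of_check₄ (h : R.check₄ = true) :
    R.p.Prime ∧ 5 ≤ R.p ∧ (R.e.baseChange ℚ).IsElliptic ∧ (R.e.baseChange ℚ).IsGloballyMinimal := by
  obtain ⟨hP, h5, hΔ, -, -, hmin, -⟩ := check₄_spec h
  exact ⟨hP, h5, Literature.NumberTheory.EllipticCurves.isElliptic_baseChange_int _ fun h0 =>
    hΔ (by rw [h0]; exact dvd_zero _), isGloballyMinimal_of_minCheck₄ hmin⟩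

/-- A row passing `check₄` is good ORDINARY at `p` (H1), the tree's `#Ẽ(𝔽_p)` is the kernel count, and the
Tamagawa product IS the certificate's `rowValueZ` (H9) — bundled. [cite: SilvermanAEC2009, VII.1 Remark 1.1]
[cite: SilvermanATAEC1994, IV.9.4] -/
theorem isOrdinaryAt_reductionPointCount_tamagawaProduct_of_check₄ (h : R.check₄ = true)
    [Fact R.p.Prime] [(R.e.baseChange ℚ).IsGloballyMinimal] :
    IsOrdinaryAt (R.e.baseChange ℚ) R.p ∧
      (R.e.baseChange ℚ).reductionPointCount R.p = curveCount R.p R.e ∧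
      (R.e.baseChange ℚ).tamagawaProduct = Tam.TamZ.rowValueZ R.tam R.tamX R.tamZ := by
  obtain ⟨-, h5, hΔ, hc, hap, -, ht, hx⟩ := check₄_spec h
  have hp2 : R.p ≠ 2 := by omega
  refine ⟨isOrdinaryAt_baseChange_int_of_card R.p R.e hΔ (card_eq_curveCount R.p hp2 R.e hΔ) ?_,
    by rw [reductionPointCount_baseChange_int, card_eq_curveCount R.p hp2 R.e hΔ],
    Tam.TamZ.tamagawaProduct_eqZ ht inferInstance hx⟩
  rw [hc]
  have : (R.p : ℤ) + 1 - (R.p + 1 - R.ap) = R.ap := by ring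
  rw [this]
  exact hap

/-! ## §3. The row theorems and readers -/

/-- **TIER ROW THEOREM, frame «kato-bound», complete minimality form.** As `ShaRow.kato` for a row
passing `checkK₄`: GIVEN `hS` (PRS, BMS Thm. 1.7), Kato's Thm. 17.4 for every cyclotomic datum (`hK`), the
newform `hf`, the rank certificate `hlow : 2 ≤ rank`, `hLp : [T²] L_p ≠ 0`, `hcoeff : ord_p [T²] L_p = R.a`,
THE canonical height `Dh` with `hreg : ord_p Reg_p = R.b`: `rank_ℤ E(ℚ) = 2`, `Ш(E/ℚ)[p^∞]` finite,
`Reg_p ≠ 0`, `ord_p #Ш(E/ℚ)[p^∞] ≤ R.k`. Per pair; NOT a class theorem.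
[cite: Kato2004Asterisque, Thm. 17.4 (3) (p. 273)] [cite: BalakrishnanMullerStein2015, Thm. 1.7]
[cite: SteinWuthrich2013, Alg. 11.1 and Prop. 11.2] -/
theorem kato₄ (h : R.checkK₄ = true) [Fact R.p.Prime] [(R.e.baseChange ℚ).IsElliptic]
    [(R.e.baseChange ℚ).IsGloballyMinimal]
    (hS : Schneider1985_order_charGenerator_odd) {N : ℕ} [NeZero N] {f : CuspForm (Gamma0 N) 2}
    (hf : IsNewformOf (R.e.baseChange ℚ) f)
    (hK : ∀ (κ : ZpExtension ℚ R.p) (γ : Field.absoluteGaloisGroup ℚ),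
      kato_divisibility (R.e.baseChange ℚ) R.p (κ := κ) (γ := γ) (f := f))
    (hlow : 2 ≤ (R.e.baseChange ℚ).mordellWeilRank)
    (hLp : PowerSeries.coeff 2 (padicLFunction f (unitRoot (R.e.baseChange ℚ) R.p : ℚ_[R.p])) ≠ 0)
    (hcoeff : (PowerSeries.coeff 2
      (padicLFunction f (unitRoot (R.e.baseChange ℚ) R.p : ℚ_[R.p]))).valuation = R.a)
    (Dh : PAdicHeightData (R.e.baseChange ℚ) R.p) (hDh : Dh.IsCanonical)
    (hreg : (padicRegulator Dh).valuation = R.b) :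
    (R.e.baseChange ℚ).mordellWeilRank = 2 ∧
      Finite (AddCommGroup.primaryComponent (R.e.baseChange ℚ).sha R.p) ∧ SchneiderConjecture Dh ∧
      (padicValNat R.p (Nat.card (AddCommGroup.primaryComponent (R.e.baseChange ℚ).sha R.p)) : ℤ) ≤
        R.k := by
  have hb := check₄_of_checkK₄ h
  obtain ⟨hord, hcnt, htam⟩ := isOrdinaryAt_reductionPointCount_tamagawaProduct_of_check₄ hb
  have hsurj : (R.e.baseChange ℚ).HasSurjectiveModNGaloisRep R.p :=
    SurjWitness.surj_of_check (swcheck_of_checkK₄ h) _ (integralModelInt_baseChange_int R.e)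
  obtain ⟨hr, hfin, hSch, hle⟩ := card_shaPrimary_le_of_kato_certificate hS (R.e.baseChange ℚ) R.p f
    hK (prime_isElliptic_isGloballyMinimal_of_check₄ hb).2.1 hord hsurj hf hlow hLp Dh hDh hcoeff hreg
  refine ⟨hr, hfin, hSch, ?_⟩
  rw [hcnt, htam] at hle
  rw [ShaRow.k]
  push_cast at hle ⊢
  linarith

/-- **Frame «kato-bound», complete minimality form, `R.k ≤ 0`: `Ш(E/ℚ)[p^∞] = 0` exactly.**
[cite: SteinWuthrich2013, Thm. 1.1 and Alg. 11.1] [cite: Kato2004Asterisque, Thm. 17.4 (3) (p. 273)] -/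
theorem kato₄_eq_one (h : R.checkK₄ = true) [Fact R.p.Prime] [(R.e.baseChange ℚ).IsElliptic]
    [(R.e.baseChange ℚ).IsGloballyMinimal]
    (hS : Schneider1985_order_charGenerator_odd) {N : ℕ} [NeZero N] {f : CuspForm (Gamma0 N) 2}
    (hf : IsNewformOf (R.e.baseChange ℚ) f)
    (hK : ∀ (κ : ZpExtension ℚ R.p) (γ : Field.absoluteGaloisGroup ℚ),
      kato_divisibility (R.e.baseChange ℚ) R.p (κ := κ) (γ := γ) (f := f))
    (hlow : 2 ≤ (R.e.baseChange ℚ).mordellWeilRank)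
    (hLp : PowerSeries.coeff 2 (padicLFunction f (unitRoot (R.e.baseChange ℚ) R.p : ℚ_[R.p])) ≠ 0)
    (hcoeff : (PowerSeries.coeff 2
      (padicLFunction f (unitRoot (R.e.baseChange ℚ) R.p : ℚ_[R.p]))).valuation = R.a)
    (Dh : PAdicHeightData (R.e.baseChange ℚ) R.p) (hDh : Dh.IsCanonical)
    (hreg : (padicRegulator Dh).valuation = R.b) (hk0 : R.k ≤ 0) :
    (R.e.baseChange ℚ).mordellWeilRank = 2 ∧
      Finite (AddCommGroup.primaryComponent (R.e.baseChange ℚ).sha R.p) ∧ SchneiderConjecture Dh ∧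
      Nat.card (AddCommGroup.primaryComponent (R.e.baseChange ℚ).sha R.p) = 1 := by
  obtain ⟨hr, hfin, hSch, hle⟩ := kato₄ h hS hf hK hlow hLp hcoeff Dh hDh hreg
  haveI := hfin
  have hv0 : padicValNat R.p (Nat.card (AddCommGroup.primaryComponent (R.e.baseChange ℚ).sha R.p)) = 0 := by
    have := hle.trans hk0
    omega
  have hndvd : ¬ R.p ∣ Nat.card (AddCommGroup.primaryComponent (R.e.baseChange ℚ).sha R.p) := by
    rcases padicValNat.eq_zero_iff.mp hv0 with h1 | h0 | hnd
    · exact absurd h1 (Fact.out : R.p.Prime).one_lt.ne'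
    · exact absurd h0 Nat.card_pos.ne'
    · exact hnd
  exact ⟨hr, hfin, hSch, natCard_primaryComponent_eq_one R.p hndvd⟩

/-- **READER, V-BOUND 0, complete minimality form** («`Ш(E/ℚ)[p^∞] = 0`»): from the row certificate
`checkK₄ ∧ k ≤ 0 ∧ 2 ≤ rank`, GIVEN `hS`, the newform, Kato's Thm. 17.4 for every cyclotomic datum, the
L-datum and THE canonical height datum: `rank_ℤ E(ℚ) = 2`, `Ш(E/ℚ)[p^∞]` finite, `Reg_p ≠ 0`,
`#Ш(E/ℚ)[p^∞] = 1`. [cite: Kato2004Asterisque, Thm. 17.4 (3) (p. 273)] [cite: Serre1972, §2.8 Prop. 19]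
[cite: SteinWuthrich2013, Alg. 11.1 and Prop. 11.2] -/
theorem booked_katoOne₄ (h : R.checkK₄ = true ∧ R.k ≤ 0 ∧ 2 ≤ (R.e.baseChange ℚ).mordellWeilRank) :
    haveI : Fact R.p.Prime := ⟨(prime_isElliptic_isGloballyMinimal_of_check₄ (check₄_of_checkK₄ h.1)).1⟩
    haveI := (prime_isElliptic_isGloballyMinimal_of_check₄ (check₄_of_checkK₄ h.1)).2.2.1
    haveI := (prime_isElliptic_isGloballyMinimal_of_check₄ (check₄_of_checkK₄ h.1)).2.2.2
    ∀ (_hS : Schneider1985_order_charGenerator_odd) {N : ℕ} [NeZero N] {f : CuspForm (Gamma0 N) 2}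
      (_hf : IsNewformOf (R.e.baseChange ℚ) f)
      (_hK : ∀ (κ : ZpExtension ℚ R.p) (γ : Field.absoluteGaloisGroup ℚ),
        kato_divisibility (R.e.baseChange ℚ) R.p (κ := κ) (γ := γ) (f := f))
      (_hLp : PowerSeries.coeff 2 (padicLFunction f (unitRoot (R.e.baseChange ℚ) R.p : ℚ_[R.p])) ≠ 0)
      (_hcoeff : (PowerSeries.coeff 2
        (padicLFunction f (unitRoot (R.e.baseChange ℚ) R.p : ℚ_[R.p]))).valuation = R.a)
      (Dh : PAdicHeightData (R.e.baseChange ℚ) R.p) (_hDh : Dh.IsCanonical)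
      (_hreg : (padicRegulator Dh).valuation = R.b),
      (R.e.baseChange ℚ).mordellWeilRank = 2 ∧
        Finite (AddCommGroup.primaryComponent (R.e.baseChange ℚ).sha R.p) ∧ SchneiderConjecture Dh ∧
        Nat.card (AddCommGroup.primaryComponent (R.e.baseChange ℚ).sha R.p) = 1 := by
  intro hS N _ f hf hK hLp hcoeff Dh hDh hreg
  haveI : Fact R.p.Prime := ⟨(prime_isElliptic_isGloballyMinimal_of_check₄ (check₄_of_checkK₄ h.1)).1⟩
  haveI := (prime_isElliptic_isGloballyMinimal_of_check₄ (check₄_of_checkK₄ h.1)).2.2.1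
  haveI := (prime_isElliptic_isGloballyMinimal_of_check₄ (check₄_of_checkK₄ h.1)).2.2.2
  exact kato₄_eq_one h.1 hS hf hK h.2.2 hLp hcoeff Dh hDh hreg h.2.1

/-- **READER, V-BOUND `b`, complete minimality form**: from `checkK₄ ∧ 2 ≤ rank`: `rank = 2`,
`Ш(E/ℚ)[p^∞]` finite, `Reg_p ≠ 0`, `ord_p #Ш(E/ℚ)[p^∞] ≤ R.k`. [cite: Kato2004Asterisque, Thm. 17.4 (3) (p. 273)]
[cite: Serre1972, §2.8 Prop. 19] [cite: SteinWuthrich2013, Alg. 11.1 and Prop. 11.2] -/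
theorem booked_katoLe₄ (h : R.checkK₄ = true ∧ 2 ≤ (R.e.baseChange ℚ).mordellWeilRank) :
    haveI : Fact R.p.Prime := ⟨(prime_isElliptic_isGloballyMinimal_of_check₄ (check₄_of_checkK₄ h.1)).1⟩
    haveI := (prime_isElliptic_isGloballyMinimal_of_check₄ (check₄_of_checkK₄ h.1)).2.2.1
    haveI := (prime_isElliptic_isGloballyMinimal_of_check₄ (check₄_of_checkK₄ h.1)).2.2.2
    ∀ (_hS : Schneider1985_order_charGenerator_odd) {N : ℕ} [NeZero N] {f : CuspForm (Gamma0 N) 2}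
      (_hf : IsNewformOf (R.e.baseChange ℚ) f)
      (_hK : ∀ (κ : ZpExtension ℚ R.p) (γ : Field.absoluteGaloisGroup ℚ),
        kato_divisibility (R.e.baseChange ℚ) R.p (κ := κ) (γ := γ) (f := f))
      (_hLp : PowerSeries.coeff 2 (padicLFunction f (unitRoot (R.e.baseChange ℚ) R.p : ℚ_[R.p])) ≠ 0)
      (_hcoeff : (PowerSeries.coeff 2
        (padicLFunction f (unitRoot (R.e.baseChange ℚ) R.p : ℚ_[R.p]))).valuation = R.a)
      (Dh : PAdicHeightData (R.e.baseChange ℚ) R.p) (_hDh : Dh.IsCanonical)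
      (_hreg : (padicRegulator Dh).valuation = R.b),
      (R.e.baseChange ℚ).mordellWeilRank = 2 ∧
        Finite (AddCommGroup.primaryComponent (R.e.baseChange ℚ).sha R.p) ∧ SchneiderConjecture Dh ∧
        (padicValNat R.p (Nat.card (AddCommGroup.primaryComponent (R.e.baseChange ℚ).sha R.p)) : ℤ) ≤
          R.k := by
  intro hS N _ f hf hK hLp hcoeff Dh hDh hreg
  haveI : Fact R.p.Prime := ⟨(prime_isElliptic_isGloballyMinimal_of_check₄ (check₄_of_checkK₄ h.1)).1⟩
  haveI := (prime_isElliptic_isGloballyMinimal_of_check₄ (check₄_of_checkK₄ h.1)).2.2.1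
  haveI := (prime_isElliptic_isGloballyMinimal_of_check₄ (check₄_of_checkK₄ h.1)).2.2.2
  exact kato₄ h.1 hS hf hK h.2 hLp hcoeff Dh hDh hreg

end ShaRow

end Summit.BirchSwinnertonDyer.BirchSwinnertonDyer.Rank2Sha

end
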